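import Summits.MatrixMultiplication.MatrixMultiplication.Theorems.AsymptoticRankCWBPerm3Form
import Literature.Computability.AlgebraicComplexity.XyzCubeFlattening

/-!
# Line `signed-pencil-anchor` for the crux `BThesis` (stmt-MatrixMultiplication-0588) — transfer along the Hesse pencil

`BThesis` = `R̃(T_cw,2) = 3` in growth form. LENS: transfer (solved-sibling shape: the unit points of the
Hesse pencil `T_s(x,y,z) = [x+y+z=0]·(1 if x=y else s)` are free — `T₀ = ⟨3⟩`, `T₁ ≅ ℂ[ℤ₃]`, `T_ω, T_{ω²}`
their quadratic-phase twists — and the first non-free root of unity is `−1 ∈ μ₆ ∖ μ₃`).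

Over `ℂ`, `T_cw,2 ≅ xyz` (tree: `tensorRestrictsTo_cwTensor_xyzTensor` and the inverse change of basis,
proved below as `xyz_restrictsTo_cw`) and `xyz` is the TRIANGLE point `s = −1/2` of the pencil
(`x³+y³+z³−3xyz = (x+y+z)(x+ωy+ω²z)(x+ω²y+ωz)`), a SPECIAL point (2-dimensional torus stabiliser). By the
Zariski upper-semicontinuity of `s ↦ R̃(T_s)` (CHNVZ 2025 Thm 1.2, PROVED in tree:
`chnvz_zariskiClosed_asymptoticRank_le_holds`) every member is bounded by the generic pencil value `θ_H`,
so ARC at any NON-exceptional member hands down `R̃(xyz) ≤ 3`. The anchor chosen is the signed `ℤ₃` table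
`T_{-1} = Δ − P` (entries `0, ±1`; powers `(−1)^{d_H(x,y)}·[x+y+z=0 in ℤ₃^N]`), whose two halves are
exactly the open cruxes of route HesseHammingShells filed by the ShellUniformity strategist (2026-08-17):
(1) `stub_signedTableARC` = `SignedTableARC` (stmt-MatrixMultiplication-17613) VERBATIM, `R̃(T_{-1}) ≤ 3`;
(2) `stub_xyzBelowSigned` — `R̃(xyz) ≤ R̃(T_{-1})`: the `s = −1/2` instance of `SignedTableGeneric`
(stmt-17614, "−1 is not an exceptional parameter") after the triangle identification `T_{-1/2} ≅ xyz`
(M-sized, explicit DFT matrix). Composition `BThesis_of` (kernel-checked): `R̃(T_cw,2) ≤ R̃(xyz)`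
(restriction `xyz ≥ T_cw,2`, proved here; `asymptoticRank_le_of_polyDegeneratesTo`) `≤ R̃(T_{-1}) ≤ 3`, then
the growth form by `isBigO_of_asymptoticRank_le` (the inline power in `BThesis` is `kroneckerPow (cwTensor ℂ 2) N`
by `rfl`). So provers closing 17613 ∧ 17614 close THIS crux as well; conversely this line is only as
good as ARC at `T_{-1}` (no finite savings are known there: `bR(T_s^{⊠2}) = 16` generically).
-/

set_option linter.dupNamespace false

noncomputable section

namespace Summit.MatrixMultiplication.MatrixMultiplication.Cruxes.BThesis.SignedPencilAnchor

open scoped BigOperators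
open Literature.Computability.AlgebraicComplexity
open Summit.MatrixMultiplication.MatrixMultiplication.Theorems
open Literature.Barriers.MatrixMultiplication (asymptoticRank_le_of_polyDegeneratesTo)

/-- Local alias of the crux, used ONLY as the result type of the hypothesis-form `BThesis_of` (so that the
hypothesis-free `BThesis_proof` below is the file's unique skeleton theorem concluding the route decl by name). -/
abbrev Goal : Prop := Summit.MatrixMultiplication.MatrixMultiplication.Theses.AsymptoticRankCW.BThesis

/-- STUB 1 (= crux `HesseHammingShells.SignedTableARC`, stmt-MatrixMultiplication-17613, verbatim;
open-problem): ARC at the signed table. -/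
theorem stub_signedTableARC :
    asymptoticRank (fun x y z : Fin 3 => if x + y + z = 0 then (if x = y then (1 : ℂ) else (-1 : ℂ)) else 0) ≤ 3 := by
  sorry

/-- STUB 2 (content, size L; = `SignedTableGeneric` (stmt-17614) at `s = −1/2` modulo `T_{-1/2} ≅ xyz`):
the triangle point is dominated by the signed table. -/
theorem stub_xyzBelowSigned :
    asymptoticRank (xyzTensor ℂ) ≤
      asymptoticRank (fun x y z : Fin 3 => if x + y + z = 0 then (if x = y then (1 : ℂ) else (-1 : ℂ)) else 0) := by
  sorry

/-- `xyz ≥ T_cw,2` over `ℂ` (the inverse `Q` of the tree's change of basis `cwToXyz`; proved, not a stub —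
the same computation as in the deciding theorem of route CwPowerHosting). -/
theorem xyz_restrictsTo_cw : TensorRestrictsTo (xyzTensor ℂ) (cwTensor ℂ 2) := by
  let Q : Fin 3 → Fin 3 → ℂ :=
    ![![1, 0, 0], ![0, ((1 : ℝ) / 2 : ℝ), 1], ![0, -(((1 : ℝ) / 2 : ℝ) * Complex.I), Complex.I]]
  have hsum : ∀ f : Fin 3 → Fin 3 → Fin 3 → ℂ,
      ∑ a, ∑ b, ∑ c, f a b c * xyzTensor ℂ a b c =
        f 0 1 2 + f 0 2 1 + f 1 0 2 + f 1 2 0 + f 2 0 1 + f 2 1 0 := by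
    intro f
    simp only [Fin.sum_univ_three, xyzTensor_apply, comp1]
    simp
    ring
  refine ⟨Q, Q, Q, fun a b c => ?_⟩
  rw [hsum (fun x y z => Q a x * Q b y * Q c z)]
  fin_cases a <;> fin_cases b <;> fin_cases c <;>
    simp [Q, cwTensor_apply, Complex.ext_iff] <;> norm_num

/-- COMPOSITION (kernel-checked, no sorry): ARC at the anchor + domination + `xyz ≥ T_cw,2` ⇒ `BThesis` by name. -/
theorem BThesis_of
    (h₁ : asymptoticRank (fun x y z : Fin 3 => if x + y + z = 0 then (if x = y then (1 : ℂ) else (-1 : ℂ)) else 0) ≤ 3)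
    (h₂ : asymptoticRank (xyzTensor ℂ) ≤
      asymptoticRank (fun x y z : Fin 3 => if x + y + z = 0 then (if x = y then (1 : ℂ) else (-1 : ℂ)) else 0)) :
    Goal := by
  unfold Goal Summit.MatrixMultiplication.MatrixMultiplication.Theses.AsymptoticRankCW.BThesis
  have hcw : asymptoticRank (cwTensor ℂ 2) ≤ asymptoticRank (xyzTensor ℂ) :=
    asymptoticRank_le_of_polyDegeneratesTo xyz_restrictsTo_cw.polyDegeneratesTo
  intro ε hε
  exact isBigO_of_asymptoticRank_le (cwTensor ℂ 2) (by norm_num) ((hcw.trans h₂).trans h₁) hε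

/-- SKELETON THEOREM: the crux `BThesis` BY NAME from the declared stubs (sorries only inside `stub_*`). -/
theorem BThesis_proof : Summit.MatrixMultiplication.MatrixMultiplication.Theses.AsymptoticRankCW.BThesis :=
  BThesis_of stub_signedTableARC stub_xyzBelowSigned

end Summit.MatrixMultiplication.MatrixMultiplication.Cruxes.BThesis.SignedPencilAnchor

end
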